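import Summits.QuantumAdvantage.QuantumAdvantage.Theorems.CubicForrelationNearExactIsExactEighteenTypeO
import Summits.QuantumAdvantage.QuantumAdvantage.Theorems.CubicForrelationNearExactIsExactIsolationSmallN
import Summits.QuantumAdvantage.QuantumAdvantage.Theorems.CubicForrelationNearExactIsExactMmFormCeilingA
import Summits.QuantumAdvantage.QuantumAdvantage.Theorems.CubicForrelationNearExactIsExactConcatAveraging
import Summits.QuantumAdvantage.QuantumAdvantage.Theorems.NearExactIsExact.Negative.MmPairFixedPoints
import Summits.QuantumAdvantage.QuantumAdvantage.Theorems.NearExactIsExact.Negative.FifteenSixteenths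
import Literature.Computability.QuantumComplexity.ForrelationDirectSum

/-!
# Crux `CubicForrelation.NearExactIsExact` (stmt-QuantumAdvantage-14043) — isolation at `63/64` on 18 bits:
  `θ₁₈ ∈ [15/16, 63/64]`

Certificate seat `b2b-cforr-cert` (gen 3, 2026-08-19).  HONEST FRAMING: the value here is a DECIDABLE VERDICT about the finite
slice `n = 18` of the crux — a kernel-checked THEOREM — NOT summit progress (the crux asks for ONE `θ < 1` uniform in `n`).

THEOREM `isolation_eighteen_63_64`: **for all cubic `f, g : 𝔽₂¹⁸ → 𝔽₂`, `Φ(f,g) > 63/64 ⇒ Φ(f,g) = 1`.**  For `n = 18` the tree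
so far only had the uniform window constant `1 − 2⁻¹⁰` (`isolation_window_le_28`), and the 2-adic tower by itself stops at `127/128`
(its bottleneck is type O: all `W_g/64` odd).  The lower half of the `n = 18` row is the direct sum of the 16-bit `15/16` pair
(`Negative/FifteenSixteenths.lean`) with the 2-bit bent pair `(z₀z₁, z₀z₁)` (`Φ = 1`, two-sided Maiorana–McFarland with `π = τ = id`
on one bit): `Φ = 15/16 · 1 = 15/16` on 18 bits (`forrelation_directSum`), so `θ₁₈ ∈ [15/16, 63/64]` (`theta_eighteen_bounds`; the
window `(15/16, 63/64]` is OPEN).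

Proof.  ONE-SIDED (capacity of `g` alone; `Φ(f,g)·2²⁷ ≤ Σ|W_g|`).  `W_g = 64u`; the level-6 parity is constant:
* type O (all `u` odd): `Σ|W_g| ≤ (63/64)·2²⁷` by `ei_typeO_capacity` (`…EighteenTypeO`: digits, one pointwise inequality,
  Reed–Muller weight, and no case A by the saturated-tiling parity at `18 = 3·6`);
* all `u` even: the landed tower continues — level 7 (affine parity, cost `63/64`), level 8 (cubic parity, cost `63/64`), the bent
  level 9 (bent or cost `31/32`), and a bent cubic on 18 bits has a dual of degree `≤ 6`, so `Φ = 1 ∨ Φ ≤ 31/32` (`tw_bent_end`).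

References: J. Ax (1964) / R. J. McEliece (1972) (Carlet 2021 §4.1); O. S. Rothaus, JCTA 20 (1976); X.-D. Hou, Discrete Math. 189
(1998); C. Carlet, *Boolean Functions for Cryptography and Coding Theory*, CUP 2021; S. Aaronson, A. Ambainis, *Forrelation*,
SIAM J. Comput. 47 (2018) §1.1.1.  Everything below is proved from Mathlib and the tree; axioms are the standard three (no
`native_decide`).
-/

set_option linter.dupNamespace false -- D-0017: single-problem summit ⇒ `QuantumAdvantage.QuantumAdvantage` by design

noncomputable section

namespace Summit.QuantumAdvantage.QuantumAdvantage.Theorems.CubicForrelation.NearExactIsExact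

open Finset
open Literature.Computability.QuantumComplexity
open Literature.Computability.QuantumComplexity.DerivativeWalsh (W)

/-- **Isolation at `63/64` on 18 bits.** For all cubic `f, g : 𝔽₂¹⁸ → 𝔽₂`: `Φ(f,g) > 63/64 ⇒ Φ(f,g) = 1` (the tree had only
`1 − 2⁻¹⁰` for `n = 18`, `isolation_window_le_28`; the tower alone gives `127/128`).  Type O: capacity `≤ 63/64`
(`ei_typeO_capacity`); level 7: cost `63/64`; level 8: cost `63/64`; level 9: bent (dual of degree `≤ 6`, `Φ = 1 ∨ Φ ≤ 31/32`) or
cost `31/32`. [this work] -/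
theorem isolation_eighteen_63_64 :
    ∀ f g : (Fin (9 + 9) → Bool) → Bool, IsDegLeFun 3 f → IsDegLeFun 3 g →
      63 / 64 < forrelation f g → forrelation f g = 1 := by
  intro f g hf hg hΦ
  obtain ⟨u₆, hu₆⟩ := tw_base g hg 6 (by norm_num)
  by_cases hodd : ∃ x, Odd (u₆ x)
  · exfalso
    have hall := ei_typeO_of_exists_odd g u₆ hg hu₆ hodd
    have := tw_forrelation_le_of_cap f g (ei_typeO_capacity g u₆ hg hu₆ hall)
    linarith
  · push Not at hodd
    have hu₇ := tw_level_up g u₆ hu₆ hodd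
    rcases tw_step (j := 7) (d := 1) g (fun x => u₆ x / 2) hg (by norm_num) hu₇ (by intro k hk hkn; omega)
      with hcap | ⟨u₈, hu₈⟩
    · exfalso; have := tw_forrelation_le_of_cap f g hcap; norm_num at this; linarith
    rcases tw_step (j := 8) (d := 3) g u₈ hg (by norm_num) hu₈ (by intro k hk hkn; omega) with hcap | ⟨u₉, hu₉⟩
    · exfalso; have := tw_forrelation_le_of_cap f g hcap; norm_num at this; linarith
    rcases tw_top (d := 4) g u₉ hg hu₉ (by intro k hk hkn; omega) with hbent | hcap
    · rcases tw_bent_end (by norm_num) f g hf hg hbent with h | h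
      · exact h
      · exfalso; norm_num at h; linarith
    · exfalso; have := tw_forrelation_le_of_cap f g hcap; norm_num at this; linarith

/-- **No cubic pair on 18 bits has `Φ ∈ (63/64, 1)`.** [this work] -/
theorem no_window_eighteen_63_64 :
    ¬ ∃ f g : (Fin (9 + 9) → Bool) → Bool, IsDegLeFun 3 f ∧ IsDegLeFun 3 g ∧
      63 / 64 < forrelation f g ∧ forrelation f g < 1 := by
  rintro ⟨f, g, hf, hg, hlo, hhi⟩
  exact absurd (isolation_eighteen_63_64 f g hf hg hlo) (ne_of_lt hhi)

/-- The `n = 18` slice of `NearExactIsExact` fails only through values `≤ 63/64`: restricted to 18 bits the crux HOLDS with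
`θ = 63/64`. [this work] -/
theorem nearExact_slice_eighteen_63_64 :
    ∀ f g : (Fin (9 + 9) → Bool) → Bool, IsDegLeFun 3 f → IsDegLeFun 3 g →
      forrelation f g ≠ 1 → forrelation f g ≤ 63 / 64 := by
  intro f g hf hg hne
  by_contra hlt
  push Not at hlt
  exact hne (isolation_eighteen_63_64 f g hf hg hlt)

/-! ### The lower half: `Φ = 15/16` is attained on 18 bits (direct sum with a 2-bit bent pair) -/

open Summit.QuantumAdvantage.QuantumAdvantage.Theorems.NearExactIsExact.Negative
  (f16 g16 isDegLeFun_f16 isDegLeFun_g16 forrelation_f16_g16)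
open Summit.QuantumAdvantage.QuantumAdvantage.Theorems.NearExactIsExact.Negative.MmPairFixedPoints
  (forrelation_mmPair_of_leftInverse)

/-- The 2-bit bent function `z₀ z₁` is quadratic. [folklore] -/
theorem ei_isDegLeFun_and2 : IsDegLeFun 2 (fun z : Fin (1 + 1) → Bool => z 0 && z 1) :=
  bb_deg_and (isDegLeFun_apply 0 le_rfl) (isDegLeFun_apply 1 le_rfl) (by norm_num)

/-- **The 2-bit bent pair is exact**: `Φ(z₀z₁, z₀z₁) = 1` (two-sided Maiorana–McFarland with `π = τ = id` on one bit: both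
fixed points count, `forrelation_mmPair_of_leftInverse`). [folklore] -/
theorem ei_forrelation_and2 :
    forrelation (fun z : Fin (1 + 1) → Bool => z 0 && z 1) (fun z : Fin (1 + 1) → Bool => z 0 && z 1) = 1 := by
  have happ : ∀ y₁ y₂ : Fin 1 → Bool,
      (fun z : Fin (1 + 1) → Bool => z 0 && z 1) (Fin.append y₁ y₂) = (y₁ 0 && y₂ 0) := by
    intro y₁ y₂
    show (Fin.append y₁ y₂ (Fin.castAdd 1 0) && Fin.append y₁ y₂ (Fin.natAdd 1 0)) = _
    rw [Fin.append_left, Fin.append_right]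
  have htw : ∀ y₁ y₂ : Fin 1 → Bool, twist y₁ y₂ = signOf (y₁ 0 && y₂ 0) := by
    intro y₁ y₂
    unfold twist signOf
    rw [Fin.prod_univ_one]
  have hg : ∀ y₁ y₂ : Fin 1 → Bool, signOf ((fun z : Fin (1 + 1) → Bool => z 0 && z 1) (Fin.append y₁ y₂)) =
      twist y₁ (id y₂) * signOf false := by
    intro y₁ y₂
    rw [happ, htw]
    simp [signOf]
  have hf : ∀ x₁ x₂ : Fin 1 → Bool, signOf ((fun z : Fin (1 + 1) → Bool => z 0 && z 1) (Fin.append x₁ x₂)) =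
      twist x₂ (id x₁) * signOf false := by
    intro x₁ x₂
    rw [happ, htw, Bool.and_comm]
    simp [signOf]
  rw [forrelation_mmPair_of_leftInverse _ _ id id (fun _ => false) (fun _ => false) hg hf fun _ => rfl]
  simp [signOf]

/-- The direct sum `f16 ⊕ z₀z₁` on `16 + 2` bits is cubic. -/
theorem ei_isDegLeFun_f18 :
    IsDegLeFun 3 (fun x : Fin (8 + 8 + (1 + 1)) → Bool =>
      xor (f16 fun i => x (Fin.castAdd (1 + 1) i)) ((fun z : Fin (1 + 1) → Bool => z 0 && z 1) fun j => x (Fin.natAdd (8 + 8) j))) :=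
  bb_isDegLeFun_bxor
    (fc_isDegLeFun_comp isDegLeFun_f16 (fun x i => x (Fin.castAdd (1 + 1) i)) (fun v => isDegLeFun_apply _ le_rfl)
      (by norm_num))
    (fc_isDegLeFun_comp ei_isDegLeFun_and2 (fun x j => x (Fin.natAdd (8 + 8) j)) (fun v => isDegLeFun_apply _ le_rfl)
      (by norm_num))

/-- The direct sum `g16 ⊕ z₀z₁` on `16 + 2` bits is cubic. -/
theorem ei_isDegLeFun_g18 :
    IsDegLeFun 3 (fun y : Fin (8 + 8 + (1 + 1)) → Bool =>
      xor (g16 fun i => y (Fin.castAdd (1 + 1) i)) ((fun z : Fin (1 + 1) → Bool => z 0 && z 1) fun j => y (Fin.natAdd (8 + 8) j))) :=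
  bb_isDegLeFun_bxor
    (fc_isDegLeFun_comp isDegLeFun_g16 (fun x i => x (Fin.castAdd (1 + 1) i)) (fun v => isDegLeFun_apply _ le_rfl)
      (by norm_num))
    (fc_isDegLeFun_comp ei_isDegLeFun_and2 (fun x j => x (Fin.natAdd (8 + 8) j)) (fun v => isDegLeFun_apply _ le_rfl)
      (by norm_num))

/-- **`Φ = 15/16` is attained by a cubic pair on 18 bits**: the direct sum of the 16-bit biquadratic Maiorana–McFarland pair
(`forrelation_f16_g16 = 15/16`) with the exact 2-bit pair (`Φ` is multiplicative under direct sums, `forrelation_directSum`).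
[this work] -/
theorem ei_forrelation_pair18 :
    forrelation (n := 8 + 8 + (1 + 1))
      (fun x => xor (f16 fun i => x (Fin.castAdd (1 + 1) i)) ((fun z : Fin (1 + 1) → Bool => z 0 && z 1) fun j => x (Fin.natAdd (8 + 8) j)))
      (fun y => xor (g16 fun i => y (Fin.castAdd (1 + 1) i)) ((fun z : Fin (1 + 1) → Bool => z 0 && z 1) fun j => y (Fin.natAdd (8 + 8) j)))
      = 15 / 16 := by
  rw [forrelation_directSum f16 g16 (fun z : Fin (1 + 1) → Bool => z 0 && z 1) (fun z : Fin (1 + 1) → Bool => z 0 && z 1),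
    forrelation_f16_g16, ei_forrelation_and2, mul_one]

/-- **`θ₁₈ ∈ [15/16, 63/64]`** — the new `n = 18` row of the certified `θ_n` ladder, as ONE theorem at the literal type `Fin 18`:
isolation of exactness for cubic pairs on 18 bits holds above `63/64` (`isolation_eighteen_63_64`), and no `θ < 15/16` isolates
(the direct-sum pair `ei_forrelation_pair18` has `Φ = 15/16 ≠ 1`).  The window `(15/16, 63/64]` is NOT decided by the tree.
Finite-slice verdict; NOT summit progress. [this work] -/
theorem theta_eighteen_bounds :
    (∀ f g : (Fin 18 → Bool) → Bool, IsDegLeFun 3 f → IsDegLeFun 3 g →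
        (63 / 64 : ℝ) < forrelation f g → forrelation f g = 1) ∧
    ∀ θ : ℝ, (∀ f g : (Fin 18 → Bool) → Bool, IsDegLeFun 3 f → IsDegLeFun 3 g →
        θ < forrelation f g → forrelation f g = 1) → 15 / 16 ≤ θ := by
  refine ⟨fun f g hf hg h => isolation_eighteen_63_64 f g hf hg h, fun θ hθ => ?_⟩
  by_contra hlt
  have h1 := hθ _ _ ei_isDegLeFun_f18 ei_isDegLeFun_g18 (by rw [ei_forrelation_pair18]; linarith)
  rw [ei_forrelation_pair18] at h1
  norm_num at h1

end Summit.QuantumAdvantage.QuantumAdvantage.Theorems.CubicForrelation.NearExactIsExact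

end
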